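import Mathlib
import Literature.NumberTheory.Sieve.RoughDivisorPowerSums
import Literature.NumberTheory.Sieve.SieveFramework
import HarnessLib

/-!
# Route ParityLeakOneFifth, crux `ParityLeakSieve` (stmt-Parity-18381), skeleton `birth`:
# the Type-I comparison of stub S1 — three counting lemmas

* `sum_inv_moduli_le` — `Σ_{d ≤ D, d y-rough} 1/d ≤ (5/2)·C_R` when `log D ≤ (5/2) log y`;
* `card_moduli_le`, `card_levelDivisors_le` — `#{d} ≤ D`, `#{e ∣ P(w) : e ≤ L} ≤ L`;
* `psi_sub_theta_window_le` — `ψ(2x) − ϑ(2x) ≤ 4√x (log x + 1)`.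
-/

namespace Summit.Parity.GeneralizedHardyLittlewood.Theorems.ParityLeakOneFifth

open Finset Real
open scoped ArithmeticFunction.sigma Chebyshev
open Literature.NumberTheory.Sieve

/-- `Σ_{d ∈ 𝒟G} 1/d ≤ (5/2) C_R` for the moduli `d ≤ D`, `d` `y`-rough, when `1 < y ≤ D` and
`log D ≤ (5/2) log y` (`C_R` the constant of the tree's rough harmonic sums). -/
theorem sum_inv_moduli_le {CR : ℝ} (hCR : 0 < CR)
    (hRough : ∀ z x : ℝ, 1 < z → z ≤ x →
      ∑ d ∈ (Icc 1 ⌊x⌋₊).filter (fun n => ∀ p ∈ n.primeFactors, z ≤ ((p : ℕ) : ℝ)),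
        ((σ 0 d : ℕ) : ℝ) ^ 0 / d ≤ CR * (Real.log x / Real.log z) ^ 2 ^ 0)
    {y D : ℝ} (hy1 : 1 < y) (hyD : y ≤ D) (hratio : Real.log D / Real.log y ≤ 5 / 2) :
    ∑ d ∈ (Finset.Icc 1 ⌊D⌋₊).filter (fun d : ℕ => (d : ℝ) ≤ D ∧ ∀ p ∈ d.primeFactors, y ≤ (p : ℝ)),
      (1 : ℝ) / d ≤ 5 / 2 * CR := by
  have h := hRough y D hy1 hyD
  have hsub : (Finset.Icc 1 ⌊D⌋₊).filter (fun d : ℕ => (d : ℝ) ≤ D ∧ ∀ p ∈ d.primeFactors, y ≤ (p : ℝ)) ⊆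
      (Finset.Icc 1 ⌊D⌋₊).filter (fun n => ∀ p ∈ n.primeFactors, y ≤ ((p : ℕ) : ℝ)) := by
    intro d hd
    rw [Finset.mem_filter] at hd
    exact Finset.mem_filter.2 ⟨hd.1, hd.2.2⟩
  have h2 : CR * (Real.log D / Real.log y) ^ 2 ^ 0 = CR * (Real.log D / Real.log y) := by
    rw [pow_zero, pow_one]
  have h' : ∑ d ∈ (Finset.Icc 1 ⌊D⌋₊).filter (fun n => ∀ p ∈ n.primeFactors, y ≤ ((p : ℕ) : ℝ)),
      (1 : ℝ) / d ≤ CR * (Real.log D / Real.log y) := by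
    rw [← h2]
    refine le_trans (le_of_eq ?_) h
    refine Finset.sum_congr rfl fun d _ => ?_
    rw [pow_zero]
  calc _ ≤ ∑ d ∈ (Finset.Icc 1 ⌊D⌋₊).filter (fun n => ∀ p ∈ n.primeFactors, y ≤ ((p : ℕ) : ℝ)),
          (1 : ℝ) / d := Finset.sum_le_sum_of_subset_of_nonneg hsub fun _ _ _ => by positivity
    _ ≤ CR * (Real.log D / Real.log y) := h'
    _ ≤ CR * (5 / 2) := mul_le_mul_of_nonneg_left hratio hCR.le
    _ = 5 / 2 * CR := by ring

/-- `#{d ≤ D, …} ≤ D` for `D ≥ 0`. -/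
theorem card_moduli_le {y D : ℝ} (hD0 : 0 ≤ D) :
    (#((Finset.Icc 1 ⌊D⌋₊).filter (fun d : ℕ => (d : ℝ) ≤ D ∧ ∀ p ∈ d.primeFactors, y ≤ (p : ℝ))) : ℝ) ≤ D := by
  have h1 : #((Finset.Icc 1 ⌊D⌋₊).filter (fun d : ℕ => (d : ℝ) ≤ D ∧ ∀ p ∈ d.primeFactors, y ≤ (p : ℝ))) ≤
      ⌊D⌋₊ := by
    calc _ ≤ #(Finset.Icc 1 ⌊D⌋₊) := Finset.card_filter_le _ _
      _ = ⌊D⌋₊ := by simp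
  calc _ ≤ (⌊D⌋₊ : ℝ) := by exact_mod_cast h1
    _ ≤ D := Nat.floor_le hD0

/-- `#{e ∣ P(w) : e ≤ L} ≤ L` for `L ≥ 0`. -/
theorem card_levelDivisors_le {w L : ℝ} (hL : 0 ≤ L) :
    (#((primesProdBelow w).divisors.filter (fun e : ℕ => (e : ℝ) ≤ L)) : ℝ) ≤ L := by
  have h1 : #((primesProdBelow w).divisors.filter (fun e : ℕ => (e : ℝ) ≤ L)) ≤ ⌊L⌋₊ := by
    calc _ ≤ #(Finset.Icc 1 ⌊L⌋₊) := by
          refine Finset.card_le_card fun e he => ?_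
          rw [Finset.mem_filter] at he
          rw [Finset.mem_Icc]
          exact ⟨Nat.pos_of_mem_divisors he.1, Nat.le_floor he.2⟩
      _ = ⌊L⌋₊ := by simp
  calc _ ≤ (⌊L⌋₊ : ℝ) := by exact_mod_cast h1
    _ ≤ L := Nat.floor_le hL

/-- `ψ(2x) − ϑ(2x) ≤ 4 √x (log x + 1)` for `x ≥ 1`. -/
theorem psi_sub_theta_window_le {x : ℕ} (hx : 1 ≤ x) :
    ψ ((2 * x : ℕ) : ℝ) - θ ((2 * x : ℕ) : ℝ) ≤ 4 * Real.sqrt x * (Real.log (x : ℝ) + 1) := by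
  have hx0 : (0 : ℝ) < x := by exact_mod_cast hx
  have hx1 : (1 : ℝ) ≤ x := by exact_mod_cast hx
  have h := Chebyshev.psi_sub_theta_le (x := ((2 * x : ℕ) : ℝ)) (by push_cast; linarith)
  have hs : Real.sqrt ((2 * x : ℕ) : ℝ) ≤ 2 * Real.sqrt x := by
    have e4 : (2 : ℝ) * Real.sqrt x = Real.sqrt (4 * x) := by
      rw [Real.sqrt_mul (by norm_num : (0:ℝ) ≤ 4),
        show Real.sqrt 4 = 2 by rw [show (4:ℝ) = 2 ^ 2 by norm_num, Real.sqrt_sq (by norm_num)]]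
    rw [e4]
    exact Real.sqrt_le_sqrt (by push_cast; linarith)
  have hl : Real.log ((2 * x : ℕ) : ℝ) ≤ Real.log (x : ℝ) + 1 := by
    push_cast
    rw [Real.log_mul (by norm_num) hx0.ne']
    have := Real.log_two_lt_d9; linarith
  have hl0 : 0 ≤ Real.log ((2 * x : ℕ) : ℝ) := Real.log_nonneg (by push_cast; linarith)
  calc ψ ((2 * x : ℕ) : ℝ) - θ ((2 * x : ℕ) : ℝ)
      ≤ 2 * Real.sqrt ((2 * x : ℕ) : ℝ) * Real.log ((2 * x : ℕ) : ℝ) := h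
    _ ≤ 2 * (2 * Real.sqrt x) * (Real.log (x : ℝ) + 1) :=
        mul_le_mul (mul_le_mul_of_nonneg_left hs (by norm_num)) hl hl0 (by positivity)
    _ = 4 * Real.sqrt x * (Real.log (x : ℝ) + 1) := by ring

end Summit.Parity.GeneralizedHardyLittlewood.Theorems.ParityLeakOneFifth
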